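import Summits.BirchSwinnertonDyer.Rank1Residual.X12.CMRamifiedRecordSchemaITwin
import Summits.BirchSwinnertonDyer.Rank1Residual.PrintCfram.LocalThreeTorsionZpThreeGr
import HarnessLib

/-!
# PART I MEANING — the frame-local hypothesis «`t_cs = 0` at the frame field» DISCHARGED BY NAME from a
# consistent `TcsRow` with `tcs = 0` (both members), and its failure on the rows with `tcs ≥ 1`
# (cell `bsd-print-cfram`, typer seat `ty3`; addendum to `X12/CMRamifiedRecordSchemaI{Meaning,Twin}.lean`,
# consumer side = ty2's `PrintCfram/LocalThreeTorsionZpThreeGr.lean` §2 `…_of_inertTamagawa_frame` pair)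

HONEST FRAMING (cell `bsd-print-cfram`, run/shared/lean/pub/bsd-print-cfram/, verbatim in every file
of the cell): PARTITION currency only — the leaf counts when its class theorem is in the kernel BY
NAME, flag-free; Literature named facts are statement-only with cite tags, never sorried theorems;
every imported theorem carries its printed hypotheses verbatim; numbers, not adjectives. THIS FILE:
THEOREMS ONLY (no definition, no named fact, no `sorry`); compositions of landed theorems; nothing about
BSD is asserted or booked; the carriers (IMC)₃♮ / (PR|IMC)₃♮ and (IMC)₃ / (PR|IMC)₃
(`X12/O11/RamifiedEllipticUnitMechanismZpThree{,Gr}.lean`) stay `@[conjecture]`; regime children N / T / V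
of crux C1, the crux, and the leaf stay OPEN; route items 21352 / 21353 stay ASIDE; no mark moves.
beyond-print theorem: NO.

## What is here

ty2's frame-local pair (`X12.O11.ramifiedCMEllipticUnitIMCAtZpThree_of_imcGr_of_inertTamagawa_frame`,
`X12.O11.ramifiedCMBottomClassIndexLawAtZpThree_of_indexLawGr_of_inertTamagawa_frame`) turns the
defect-complete `ℤ₃`-level carriers (IMC)₃♮ / (PR|IMC)₃♮ of a curve `W` into gen 1's regime-N carriers
(IMC)₃ / (PR|IMC)₃ (the bodies of route items 21353 / 21352) under ONE hypothesis, quantified over the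
frames of `W`:

  `ht : ∀ K 𝔭 W' C, IsFrameThree W K 𝔭 W' C → padicValNat 3 (inertTamagawaProductThree W K) = 0`

(«`t_cs(W) = 0` for the frame field `ℚ(√−3)`»). This file reads `ht` off the PART I displays
(`X12/CMRamifiedTcsThree{A..F}.lean`, 919 consistent `TcsRow`s):

* §1 `TcsRow.inertTamagawa_frame_of_tcs_eq_zero` — a consistent row `r` with `r.tcs = 0` PROVES `ht`
  for every `W/ℚ` with a model `C • W = (y² = x³ + r.k)`; `…_twin` — the same for the twin member
  (`C • W' = (y² = x³ + k')`, `k' = −27·r.k` or `k' = −(r.k/27)` with `27 ∣ r.k`);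
  `TcsRow.not_inertTamagawa_frame_of_tcs_ne_zero` — on a row with `r.tcs ≠ 0`, `ht` is FALSE as soon
  as one frame exists (at every frame `ord₃ (inertTamagawaProductThree W K) = r.tcs ≥ 1`).
* §2 the compositions: `TcsRow.ramifiedCMEllipticUnitIMCAtZpThree_of_imcGr(_twin)` and
  `TcsRow.ramifiedCMBottomClassIndexLawAtZpThree_of_indexLawGr(_twin)` — for a consistent row with
  `tcs = 0` and either member `W` of its class: (IMC)₃♮ `W` → (IMC)₃ `W`, (PR|IMC)₃♮ `W` → (PR|IMC)₃ `W`.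

Population (PART I tallies, kernel-checked in the displays): `t_cs = 0` on 451 of the 919 K12r@3 classes
— regime N 206/425 (the rows these compositions serve; the other 219 N rows are the obstruction case of
§1), T_cube 45/178, T_split 180/296, V 20/20. For a NAMED Cremona model `⟨0,0,a₃,0,a₆⟩` the model
hypothesis `hM` is `smul_eq_mordellCurve_of_a3_zero` / `smul_eq_mordellCurve_of_a3_one`
(`X12/CMRamifiedRecordModelGlue.lean`), and `r.consistent` is `TcsRow.consistent_of_tcsCheck` applied to
the display theorem of the row's file.

References: `X12/CMRamifiedRecordSchemaI{,Meaning,Twin}.lean` (p577559, p579348, p580149);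
`PrintCfram/LocalThreeTorsionZpThreeGr.lean` §2 (p580723); [PollackWeston2011] Def. 3.3, Lemma 3.4,
Prop. 3.7 (the Tamagawa exponent at inert primes; shape only); HOME/ty3/CERT-TABLE-K12r.md §PART I;
REFEREE.md R0.28 and A109 (precision erratum).
-/

namespace Summit.BirchSwinnertonDyer.Rank1Residual.X12.CMRamifiedRecords

open WeierstrassCurve NumberField IsDedekindDomain

/-! ### §1 The frame-local hypothesis from a row -/

/-- **A consistent `TcsRow` with `tcs = 0` discharges the frame-local hypothesis** of
`X12.O11.ramifiedCMEllipticUnitIMCAtZpThree_of_imcGr_of_inertTamagawa_frame` /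
`X12.O11.ramifiedCMBottomClassIndexLawAtZpThree_of_indexLawGr_of_inertTamagawa_frame`: for every `W/ℚ` with a
model `C • W = (y² = x³ + r.k)`, at every `3`-frame `(K, 𝔭, W', C')` of `W` (so `[K : ℚ] = 2`, `d_K = −3`)
`padicValNat 3 (inertTamagawaProductThree W K) = r.tcs = 0`.
[cite: PollackWeston2011, Def. 3.3 and Prop. 3.7 (shape only)] -/
theorem TcsRow.inertTamagawa_frame_of_tcs_eq_zero {r : TcsRow} (hr : r.consistent = true)
    (h0 : r.tcs = 0) (W : WeierstrassCurve ℚ) [W.IsElliptic] {C : VariableChange ℚ}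
    (hM : C • W = ⟨0, 0, 0, 0, (r.k : ℚ)⟩) :
    ∀ (K : Type) [Field K] [NumberField K] (𝔭 : HeightOneSpectrum (𝓞 K))
      (W' : WeierstrassCurve ℚ) (C' : VariableChange ℚ),
      X12.O11.IsFrameThree W K 𝔭 W' C' →
        padicValNat 3 (X12.O11.inertTamagawaProductThree W K) = 0 :=
  fun K _ _ _ _ _ hF =>
    (TcsRow.padicValNat_inertTamagawaProductThree_eq hr K hF.2.2.1.1 hF.discr_eq W hM).trans h0

/-- **The same for the twin member**: a consistent `TcsRow` with `tcs = 0` discharges the frame-local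
hypothesis for every `W'/ℚ` with a model `C • W' = (y² = x³ + k')`, `k' = −27·r.k` or (`27 ∣ r.k` and
`k' = −(r.k/27)`) — the other curve of the row's class (twin invariance `tcsClosedForm (−27k) = tcsClosedForm k`).
[cite: PollackWeston2011, Def. 3.3 and Prop. 3.7 (shape only)] -/
theorem TcsRow.inertTamagawa_frame_of_tcs_eq_zero_twin {r : TcsRow} (hr : r.consistent = true)
    (h0 : r.tcs = 0) (W' : WeierstrassCurve ℚ) [W'.IsElliptic] {C : VariableChange ℚ} {k' : ℤ}
    (hM : C • W' = ⟨0, 0, 0, 0, (k' : ℚ)⟩)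
    (hk' : k' = -27 * r.k ∨ ((27 : ℤ) ∣ r.k ∧ k' = -(r.k / 27))) :
    ∀ (K : Type) [Field K] [NumberField K] (𝔭 : HeightOneSpectrum (𝓞 K))
      (W'' : WeierstrassCurve ℚ) (C' : VariableChange ℚ),
      X12.O11.IsFrameThree W' K 𝔭 W'' C' →
        padicValNat 3 (X12.O11.inertTamagawaProductThree W' K) = 0 :=
  fun K _ _ _ _ _ hF =>
    (TcsRow.padicValNat_inertTamagawaProductThree_eq_twin hr K hF.2.2.1.1 hF.discr_eq W' hM hk').trans h0

/-- **Obstruction on the rows with `tcs ≥ 1`**: if a consistent `TcsRow` has `r.tcs ≠ 0`, then for every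
`W` with a model `C • W = (y² = x³ + r.k)` possessing at least one `3`-frame, the frame-local hypothesis
is FALSE (at that frame `padicValNat 3 (inertTamagawaProductThree W K) = r.tcs ≠ 0`). On these rows
(regime N: 219 of 425) the road «♮ pair ⟹ gen-1 pair» of `PrintCfram/LocalThreeTorsionZpThreeGr.lean` §2
is closed; the two pairs differ there by `∓ t_cs` (REFEREE.md R0.28).
[cite: PollackWeston2011, Lemma 3.4 and Prop. 3.7 (shape only)] -/
theorem TcsRow.not_inertTamagawa_frame_of_tcs_ne_zero {r : TcsRow} (hr : r.consistent = true)
    (h1 : r.tcs ≠ 0) (W : WeierstrassCurve ℚ) [W.IsElliptic] {C : VariableChange ℚ}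
    (hM : C • W = ⟨0, 0, 0, 0, (r.k : ℚ)⟩) {K : Type} [Field K] [NumberField K]
    {𝔭 : HeightOneSpectrum (𝓞 K)} {W' : WeierstrassCurve ℚ} {C' : VariableChange ℚ}
    (hF : X12.O11.IsFrameThree W K 𝔭 W' C') :
    ¬ ∀ (K : Type) [Field K] [NumberField K] (𝔭 : HeightOneSpectrum (𝓞 K))
        (W' : WeierstrassCurve ℚ) (C' : VariableChange ℚ),
        X12.O11.IsFrameThree W K 𝔭 W' C' →
          padicValNat 3 (X12.O11.inertTamagawaProductThree W K) = 0 :=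
  fun ht => h1 <|
    (TcsRow.padicValNat_inertTamagawaProductThree_eq hr K hF.2.2.1.1 hF.discr_eq W hM).symm.trans
      (ht K 𝔭 W' C' hF)

/-! ### §2 The compositions with ty2's frame-local pair: ♮ carriers ⟹ gen-1 carriers, per row -/

/-- **(IMC)₃♮ ⟹ (IMC)₃ for the member `W ≅ E_{r.k}` of a consistent row with `tcs = 0`** (composition of
`X12.O11.ramifiedCMEllipticUnitIMCAtZpThree_of_imcGr_of_inertTamagawa_frame` with §1). Route item 21353's
body at `W` is thus implied by the carrier (IMC)₃♮ at `W` on each of the 206 regime-N rows with `t_cs = 0`.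
[cite: PollackWeston2011, Prop. 3.7 (shape only)] [cite: GreenbergLNM1716, §3 Lemmas 3.1 and 3.3–3.4] -/
theorem TcsRow.ramifiedCMEllipticUnitIMCAtZpThree_of_imcGr {r : TcsRow} (hr : r.consistent = true)
    (h0 : r.tcs = 0) (W : WeierstrassCurve ℚ) [W.IsElliptic] {C : VariableChange ℚ}
    (hM : C • W = ⟨0, 0, 0, 0, (r.k : ℚ)⟩) (h1 : X12.O11.RamifiedCMEllipticUnitIMCAtZpThreeGr W) :
    X12.O11.RamifiedCMEllipticUnitIMCAtZpThree W :=
  X12.O11.ramifiedCMEllipticUnitIMCAtZpThree_of_imcGr_of_inertTamagawa_frame h1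
    (TcsRow.inertTamagawa_frame_of_tcs_eq_zero hr h0 W hM)

/-- **(IMC)₃♮ ⟹ (IMC)₃ for the twin member `W' ≅ E_{k'}`** of a consistent row with `tcs = 0`
(`k' = −27·r.k` or `k' = −(r.k/27)` with `27 ∣ r.k`).
[cite: PollackWeston2011, Prop. 3.7 (shape only)] [cite: GreenbergLNM1716, §3 Lemmas 3.1 and 3.3–3.4] -/
theorem TcsRow.ramifiedCMEllipticUnitIMCAtZpThree_of_imcGr_twin {r : TcsRow} (hr : r.consistent = true)
    (h0 : r.tcs = 0) (W' : WeierstrassCurve ℚ) [W'.IsElliptic] {C : VariableChange ℚ} {k' : ℤ}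
    (hM : C • W' = ⟨0, 0, 0, 0, (k' : ℚ)⟩)
    (hk' : k' = -27 * r.k ∨ ((27 : ℤ) ∣ r.k ∧ k' = -(r.k / 27)))
    (h1 : X12.O11.RamifiedCMEllipticUnitIMCAtZpThreeGr W') :
    X12.O11.RamifiedCMEllipticUnitIMCAtZpThree W' :=
  X12.O11.ramifiedCMEllipticUnitIMCAtZpThree_of_imcGr_of_inertTamagawa_frame h1
    (TcsRow.inertTamagawa_frame_of_tcs_eq_zero_twin hr h0 W' hM hk')

/-- **(PR|IMC)₃♮ ⟹ (PR|IMC)₃ for the member `W ≅ E_{r.k}` of a consistent row with `tcs = 0`**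
(composition of `X12.O11.ramifiedCMBottomClassIndexLawAtZpThree_of_indexLawGr_of_inertTamagawa_frame` with
§1). Route item 21352's body at `W` is thus implied by the carrier (PR|IMC)₃♮ at `W` on each of the 206
regime-N rows with `t_cs = 0`.
[cite: PerrinRiou1993AIF, §3.3.4–3.3.5] [cite: PollackWeston2011, Prop. 3.7 (shape only)] -/
theorem TcsRow.ramifiedCMBottomClassIndexLawAtZpThree_of_indexLawGr {r : TcsRow}
    (hr : r.consistent = true) (h0 : r.tcs = 0) (W : WeierstrassCurve ℚ) [W.IsElliptic]
    {C : VariableChange ℚ} (hM : C • W = ⟨0, 0, 0, 0, (r.k : ℚ)⟩)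
    (h2 : X12.O11.RamifiedCMBottomClassIndexLawAtZpThreeGr W) :
    X12.O11.RamifiedCMBottomClassIndexLawAtZpThree W :=
  X12.O11.ramifiedCMBottomClassIndexLawAtZpThree_of_indexLawGr_of_inertTamagawa_frame h2
    (TcsRow.inertTamagawa_frame_of_tcs_eq_zero hr h0 W hM)

/-- **(PR|IMC)₃♮ ⟹ (PR|IMC)₃ for the twin member `W' ≅ E_{k'}`** of a consistent row with `tcs = 0`
(`k' = −27·r.k` or `k' = −(r.k/27)` with `27 ∣ r.k`).
[cite: PerrinRiou1993AIF, §3.3.4–3.3.5] [cite: PollackWeston2011, Prop. 3.7 (shape only)] -/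
theorem TcsRow.ramifiedCMBottomClassIndexLawAtZpThree_of_indexLawGr_twin {r : TcsRow}
    (hr : r.consistent = true) (h0 : r.tcs = 0) (W' : WeierstrassCurve ℚ) [W'.IsElliptic]
    {C : VariableChange ℚ} {k' : ℤ} (hM : C • W' = ⟨0, 0, 0, 0, (k' : ℚ)⟩)
    (hk' : k' = -27 * r.k ∨ ((27 : ℤ) ∣ r.k ∧ k' = -(r.k / 27)))
    (h2 : X12.O11.RamifiedCMBottomClassIndexLawAtZpThreeGr W') :
    X12.O11.RamifiedCMBottomClassIndexLawAtZpThree W' :=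
  X12.O11.ramifiedCMBottomClassIndexLawAtZpThree_of_indexLawGr_of_inertTamagawa_frame h2
    (TcsRow.inertTamagawa_frame_of_tcs_eq_zero_twin hr h0 W' hM hk')

end Summit.BirchSwinnertonDyer.Rank1Residual.X12.CMRamifiedRecords
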